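import Literature.NumberTheory.DiophantineGeometry.MasonFundamentalInequality
import Literature.NumberTheory.DiophantineGeometry.FunctionFieldResidues
import HarnessLib

/-!
# Mason's fundamental inequality (Mason 1984, Ch. I §3, Lemma 2): the discharge

Sibling proof file of `MasonFundamentalInequality.lean` (the named fact
`Literature.NumberTheory.DiophantineGeometry.Mason1984_lemma2`, vendored AS PRINTED). This file proves
`Mason1984_lemma2_holds : Mason1984_lemma2`, following the printed proof.

R. C. Mason, *Diophantine Equations over Function Fields*, LMS Lecture Note Series 96 (CUP 1984),
Ch. I §3, Lemma 2, p. 14 (proof pp. 14–15). Mason's argument: put `f = γ₁/γ₂` (any of the ratios;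
the height `H(f) = [K : k(f)]`, Ch. I §2 eq. (2), is the number of poles counted with multiplicity);
let `V₁` be the poles of `f`, `V₂` its zeros and `V₃` the zeros of the third ratio (here `f + 1 =
-γ₃/γ₂`), with multiplicities `n_v`, so that `Σ_{V₁} n_v = Σ_{V₂} n_v = Σ_{V₃} n_v = H(f)`. By the
hypothesis `v(γ₁) = v(γ₂) = v(γ₃)` off `V`, all three sets lie in `V`, and they are pairwise disjoint.
The local inequalities (6) of Ch. I §2, `v(df/dv) ≥ v(f) - 1 = -n_v - 1` on `V₁`, `v(df/dv) ≥ n_v - 1`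
on `V₂ ∪ V₃`, `v(df/dv) ≥ 0` elsewhere, inserted in the genus formula (5), `2g - 2 = Σ_v v(df/dv)`,
give `2g - 2 ≥ -Σ_{V₁}(n_v + 1) + Σ_{V₂ ∪ V₃}(n_v - 1) = H(f) - |V₁| - |V₂| - |V₃| ≥ H(f) - |V|`.

In the tree this genus-formula step is exactly
`AlgFunctionField.finrank_sub_card_le_genus` of `FunctionFieldResidues` (the Riemann–Hurwitz formula
`Σ_P diffOrd_P(y) = 2g - 2`, `finsum_diffOrd_eq`, which is Mason's (5) with `v(df/dv) = diffOrd_v(f)`;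
the bounds (6) are `IsRational.diffOrd_nonneg` / `diffOrd_of_ord_neg` / `diffOrd_of_sub_algebraMap_mem`;
the fibre sums `Σ n_v = [F : k(f)]` are `sum_ord_sub_eq_finrank` / `sum_neg_ord_eq_finrank`,
Stichtenoth Thm. 1.4.11), applied with `a = 0`, `b = -1`; what remains here is Mason's bookkeeping:
the three fibres lie in `V` and are disjoint, and `H(γ₁/γ₂) = [F : k(γ₁/γ₂)]`.
Over an algebraically closed `k` every place is rational (`PlaceOver.isRational_of_isAlgClosed`) and
`k` is the full constant field (`isIntegrallyClosedIn_of_isAlgClosed`), as the tree lemmas require.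

## References

* R. C. Mason, *Diophantine Equations over Function Fields*, LMS LNS 96, CUP 1984, Ch. I §2 (2), (5),
  (6); §3 Lemma 2. [Mason1984]
* H. Stichtenoth, *Algebraic Function Fields and Codes*, GTM 254 (2009), Thm. 1.4.11, Cor. 3.5.5.
  [Stichtenoth2009]
-/

noncomputable section

open scoped Classical IntermediateField

namespace Literature.NumberTheory.DiophantineGeometry

open AlgFunctionField

universe u v

section bookkeeping

variable {K : Type u} {F : Type v} [Field K] [Field F] [Algebra K F]

/-- Mason's three fibres are disjoint, (i): a place where `y` has a pole is not a zero of `y - c`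
(`v(y) < 0 ⇒ v(y - c) = v(y) < 0`, strict triangle inequality). [cite: Mason1984, Ch. I §3 Lemma 2 (proof)] -/
theorem Mason1984_ord_sub_algebraMap_of_ord_neg (P : PlaceOver K F) {y : F} (hy0 : y ≠ 0)
    (h : P.ord y < 0) (c : K) : P.ord (y - algebraMap K F c) < 0 := by
  by_cases hc : c = 0
  · simpa [hc] using h
  · have hc0 : algebraMap K F (-c) ≠ 0 := (map_ne_zero _).2 (neg_ne_zero.2 hc)
    have hlt : P.ord y < P.ord (algebraMap K F (-c)) := by
      rw [PlaceOver.ord_algebraMap_holds P (neg_ne_zero.2 hc)]; exact h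
    have := (P.ord_add_eq_left_of_lt hy0 hc0 hlt).2
    rw [map_neg, ← sub_eq_add_neg] at this
    omega

end bookkeeping

/-- **Mason 1984, Ch. I §3, Lemma 2 (the fundamental inequality)** — discharge of the named fact
`Mason1984_lemma2`. For `k` algebraically closed of characteristic `0`, `F/k` a function field of one
variable of genus `g`, `γ₁ + γ₂ + γ₃ = 0` non-zero with `v(γ₁) = v(γ₂) = v(γ₃)` off the finite set `V`:
either `γ₁/γ₂ ∈ k` or `H(γ₁/γ₂) ≤ |V| + 2g - 2`. Proof as printed (Mason, pp. 14–15): with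
`y = γ₁/γ₂ ∉ k`, the poles of `y`, the zeros of `y` and the zeros of `y + 1 = -γ₃/γ₂` are three
pairwise disjoint subsets of `V`; the genus formula `2g - 2 = Σ_v v(dy/dv)` with the local bounds
`v(dy/dv) ≥ -n_v - 1` (poles), `≥ n_v - 1` (zeros of `y`, `y + 1`), `≥ 0` (elsewhere) — packaged in the
tree as `AlgFunctionField.finrank_sub_card_le_genus` — gives `[F : k(y)] - |V| ≤ 2g - 2`, and
`H(y) = Σ_v max(0, -v(y)) = [F : k(y)]` (Ch. I §2 (2); `sum_neg_ord_eq_finrank`).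
[cite: Mason1984, Ch. I §3 Lemma 2] -/
theorem Mason1984_lemma2_holds : Mason1984_lemma2 := by
  intro k _ _ _ F _ _ _ γ₁ γ₂ γ₃ V h1 h2 h3 hsum hV
  set y : F := γ₁ / γ₂ with hy_def
  by_cases hy : y ∈ Set.range (algebraMap k F)
  · exact Or.inl hy
  right
  haveI := isIntegrallyClosedIn_of_isAlgClosed (K := k) (F := F)
  have hrat : ∀ P : PlaceOver k F, P.IsRational := PlaceOver.isRational_of_isAlgClosed
  have hy0 : y ≠ 0 := div_ne_zero h1 h2
  -- the third ratio: `y - (-1) = y + 1 = -γ₃/γ₂`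
  have hy1 : y - algebraMap k F (-1) = -γ₃ / γ₂ := by
    have hγ₃ : γ₃ = -(γ₁ + γ₂) := by linear_combination hsum
    rw [map_neg, map_one, sub_neg_eq_add, hy_def, hγ₃, neg_neg, add_div, div_self h2]
  -- orders of `y` and `y + 1` in terms of the `γᵢ`
  have hordy : ∀ P : PlaceOver k F, P.ord y = P.ord γ₁ - P.ord γ₂ := fun P ↦ P.ord_div h1 h2
  have hordy0 : ∀ P : PlaceOver k F, P.ord (y - algebraMap k F 0) = P.ord γ₁ - P.ord γ₂ := fun P ↦ by
    rw [map_zero, sub_zero, hordy]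
  have hordy1 : ∀ P : PlaceOver k F, P.ord (y - algebraMap k F (-1)) = P.ord γ₃ - P.ord γ₂ :=
    fun P ↦ by rw [hy1, neg_div, P.ord_neg, P.ord_div h3 h2]
  -- Mason's `V₂`, `V₃`, `V₁`: zeros of `y`, zeros of `y + 1`, poles of `y`, all inside `V`
  set Sa : Finset (PlaceOver k F) := V.filter fun P ↦ 0 < P.ord (y - algebraMap k F 0) with hSa_def
  set Sb : Finset (PlaceOver k F) := V.filter fun P ↦ 0 < P.ord (y - algebraMap k F (-1))
    with hSb_def
  set T : Finset (PlaceOver k F) := V.filter fun P ↦ P.ord y < 0 with hT_def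
  have hSa : ∀ P : PlaceOver k F, 0 < P.ord (y - algebraMap k F 0) → P ∈ Sa := fun P hP ↦ by
    refine Finset.mem_filter.2 ⟨?_, hP⟩
    by_contra hPV
    have := hV P hPV
    rw [hordy0] at hP
    omega
  have hSb : ∀ P : PlaceOver k F, 0 < P.ord (y - algebraMap k F (-1)) → P ∈ Sb := fun P hP ↦ by
    refine Finset.mem_filter.2 ⟨?_, hP⟩
    by_contra hPV
    have := hV P hPV
    rw [hordy1] at hP
    omega
  have hT : ∀ P : PlaceOver k F, P.ord y < 0 → P ∈ T := fun P hP ↦ by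
    refine Finset.mem_filter.2 ⟨?_, hP⟩
    by_contra hPV
    have := hV P hPV
    rw [hordy] at hP
    omega
  -- the genus formula with the local bounds (Mason (5), (6)): `[F : k(y)] - #Sa - #Sb - #T ≤ 2g - 2`
  have hab : (0 : k) ≠ -1 := fun h ↦ one_ne_zero (neg_eq_zero.1 h.symm)
  have key := finrank_sub_card_le_genus hrat hy hab Sa Sb T hSa hSb hT
  -- the three fibres are pairwise disjoint subsets of `V`
  have hya : y - algebraMap k F 0 ≠ 0 := fun e ↦ hy ⟨0, (sub_eq_zero.1 e).symm⟩
  have hyb : y - algebraMap k F (-1) ≠ 0 := fun e ↦ hy ⟨-1, (sub_eq_zero.1 e).symm⟩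
  have hdab : Disjoint Sa Sb := Finset.disjoint_left.2 fun P hPa hPb ↦ by
    have ha : y - algebraMap k F 0 ∈ P.ball 1 :=
      (P.mem_ball_iff_le_ord 1 hya).2 (Finset.mem_filter.1 hPa).2
    have hb : y - algebraMap k F (-1) ∈ P.ball 1 :=
      (P.mem_ball_iff_le_ord 1 hyb).2 (Finset.mem_filter.1 hPb).2
    exact hab (P.eq_of_sub_algebraMap_mem ha hb)
  have hdT : Disjoint (Sa ∪ Sb) T := Finset.disjoint_left.2 fun P hPab hPT ↦ by
    have hneg : P.ord y < 0 := (Finset.mem_filter.1 hPT).2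
    rcases Finset.mem_union.1 hPab with hPa | hPb
    · have h0 := (Finset.mem_filter.1 hPa).2
      have := Mason1984_ord_sub_algebraMap_of_ord_neg P hy0 hneg (0 : k)
      omega
    · have h0 := (Finset.mem_filter.1 hPb).2
      have := Mason1984_ord_sub_algebraMap_of_ord_neg P hy0 hneg (-1 : k)
      omega
  have hsub : Sa ∪ Sb ∪ T ⊆ V := Finset.union_subset (Finset.union_subset (Finset.filter_subset _ _)
    (Finset.filter_subset _ _)) (Finset.filter_subset _ _)
  have hcard : Sa.card + Sb.card + T.card ≤ V.card := by
    rw [← Finset.card_union_of_disjoint hdab, ← Finset.card_union_of_disjoint hdT]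
    exact Finset.card_le_card hsub
  -- the height is the number of poles counted with multiplicity: `H(y) = [F : k(y)]` (Mason (2))
  have hH : ∑ᶠ P : PlaceOver k F, (P.degree : ℤ) * max 0 (-(P.ord y)) =
      (Module.finrank k⟮y⟯ F : ℤ) := by
    rw [← sum_neg_ord_eq_finrank hrat hy T (fun P hP ↦ (Finset.mem_filter.1 hP).2) hT,
      finsum_eq_sum_of_support_subset _ (s := T) ?_]
    · refine Finset.sum_congr rfl fun P hP ↦ ?_
      have hneg : P.ord y < 0 := (Finset.mem_filter.1 hP).2
      rw [show (P.degree : ℤ) = 1 by exact_mod_cast hrat P, one_mul, max_eq_right (by omega)]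
    · intro P hP
      rw [Function.mem_support] at hP
      refine Finset.mem_coe.2 (hT P ?_)
      by_contra hge
      exact hP (by rw [max_eq_left (by omega), mul_zero])
  rw [hH]
  have hcard' : (Sa.card : ℤ) + Sb.card + T.card ≤ V.card := by exact_mod_cast hcard
  linarith

end Literature.NumberTheory.DiophantineGeometry
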